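import Mathlib
import HarnessLib
import HarnessLib.Audit
import Summits.QuantumAdvantage.Statement
import Literature.Computability.Complexity.CircuitClasses

/-!
Route: CircuitLB

CLOSED (superseded) 2026-08-15T10:45:05Z by planner-QuantumAdvantage-route-QuantumAdvantage-CircuitLB-0 — reason: superseded:route-QuantumAdvantage-Shor — conditional-complete — Assembly+ClbFactBridge proved in tree, ClbAdleman=BPP_subset_PPoly_holds, FACT_mem_BQP_holds landed; FACT∉P/poly ⟹ FACT∉BPP: bridge = Shor∘Adleman; no unconditional line — superseded by route-QuantumAdvantage-Shor — note: ROUTE-REPAIR rrepair-QuantumAdvantage-CircuitLB-2e1b0157 (planner, 2026-08-15). CLOSED superseded by route-QuantumAdvantage-Shor: conditional-complete, UNDER FLOOR (1 hypothesis-type crux), no staffable work, and the cone block cannot be lifted at route level. CENSUS: 0252 ClbThesis (target BQP ⊄ P/. The file is kept as the record of this route; refuted decls are indexed as negative knowledge (`ledger negatives`).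

# Route QuantumAdvantage/CircuitLB — a nonuniform strengthening: BQP ⊄ P/poly

## Thesis X
Words: some BQP language has no polynomial-size Boolean circuit family.
Lean:  `¬ (Literature.Computability.Cryptography.BQP ⊆ Literature.Computability.Complexity.PPoly)`

## Assembly
`Literature.Computability.Complexity.BPP_subset_PPoly → ¬(Literature.Computability.Cryptography.BQP
⊆ Literature.Computability.Complexity.PPoly) → QuantumAdvantage`
(Adleman1978: BPP ⊆ P/poly, a named fact whose discharge is crux 2; then one line).

## Why this line
X trades the semantic class BPP for the syntactic class P/poly, moving the target into CIRCUIT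
COMPLEXITY — the one area with unconditional lower-bound techniques and with its obstructions stated
as theorems: relativization (BernsteinVazirani1997 §8: BQP^A = BPP^A for PSPACE-complete A),
algebrization (AaronsonWigderson2009 §5) and natural proofs (RazborovRudich1997: a P/poly-natural
proof of X would break every 2^{n^ε}-hard pseudorandom function family in P/poly). X is strictly
stronger than S and is the standard NONUNIFORM cryptographic assumption when instantiated at FACT
(crux 3: "factoring has no poly-size circuits", the RSA assumption against nonuniform adversaries).
The earnable mathematics is crux 2 (Adleman's theorem over the H21 `RandAlg`/`Circuit` stack:
amplification to error < 2^{-n}, union bound, hard-wiring the good coin string) and the barrier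
facts,
which every other route also needs as guards. Imported field: Boolean circuit complexity.

## Ranked cruxes
2. `Literature.Computability.Complexity.BPP_subset_PPoly` — Adleman 1978 formalised (needs
`P_subset_PPoly` + BPP amplification).
3. `Literature.Computability.QuantumComplexity.FACT ∉ Literature.Computability.Complexity.PPoly` —
nonuniform factoring assumption (hypothesis-type item; with
   `FACT_mem_BQP` gives X: `FACT_mem_BQP → FACT ∉ PPoly → X`, filed as crux 4, one line).
4. `Literature.Computability.Cryptography.FACT_mem_BQP →
Literature.Computability.QuantumComplexity.FACT ∉ Literature.Computability.Complexity.PPoly →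
¬(Literature.Computability.Cryptography.BQP ⊆ Literature.Computability.Complexity.PPoly)`.

## Kill criteria
- `BQP ⊆ P/poly` proved (e.g. via a nonuniform dequantisation) kills X but not S → close, note in
Dequantize.
- Natural-proofs barrier is not a kill but constrains method: any proof of X must be non-natural or
  break PRFs; record as cite fact.

## NOT decomposed yet
Which explicit BQP function to attack unconditionally; Williams-style "algorithms ⇒ lower bounds"
transfer for quantum classes (Arunachalam–Grilo–Gur–Oliveira–Sundaram 2021 reach BQE, not BQP) —
deliberately left out until crux 2 lands.

Sources: Adleman1978, RazborovRudich1997, AaronsonWigderson2009, BernsteinVazirani1997, Shor1997.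

UNDER FLOOR: fewer than 2 cruxes remain after retriage (legacy route; D-0019).

Novelty: NOVELTY (retriage 2026-08-14; searched BEFORE claiming: `lit search --hybrid "BQP not contained in
P/poly polynomial-size circuits quantum"`, `lit vsearch` of the thesis in prose, `lit search
"quantum learning algorithms imply circuit lower bounds"`, `lit search "Oracles are subtle but not
malicious"`, `lit search "Non-uniform cracks in the concrete"`, `lit frontier QuantumAdvantage
--since 2020`, `lit bridges QuantumAdvantage --cross any`; remote OpenAlex/S2/arXiv were
rate-limited, local store + zbMATH/Crossref answered).
Nearest prior art:
(1) The reduction X ⟹ summit is textbook: Adleman1978 = AroraBarakCC2009 Thm 7.14 (BPP ⊆ P/poly, p.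
136) with Def 6.5 (P/poly, p. 137) and Cor 10.11 (BPP ⊆ BQP, PDF p. 258); in the tree it is now the
THEOREM Literature.Computability.Complexity.BPP_subset_PPoly_holds plus the landed one-liner
Literature.QuantumAdvantage.circuitLB_assembly.
(2) The instantiation "factoring is hard for polynomial-size circuits ⟹ BQP ⊄ P/poly" is folklore
after Shor1997 §5, with non-uniform one-wayness exactly as in Goldreich2001 §2.2.5 Def 2.2.6 (lit
book:goldreich2004-foundations-cryptography p. 62: "for every (even non-uniform) family of
polynomial-size circuits"); AroraBarakCC2009 PDF p. 284 gives factoring as "the main reason to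
believe" BQP ≠ BPP.
(3) The only unconditional programme towards classical-circuit lower bounds for quantum classes is
the quantum algorithmic method arXiv:2012.01920 (Arunachalam–Grilo–Gur–Oliveira–Sundaram, FOCS 2021,
Thm 1: n  [refs: 2012.01920, 2408.16406, book:goldreich2004-foundations-cryptography, Adleman1978, AroraBarakCC2009, Shor1997, Goldreich2001, BravyiGossetKonig2018]

Barriers (technique_class: combinatorial-circuit-lower-bounds, class-separation): technique_class: combinatorial-circuit-lower-bounds, class-separation
- Literature.Barriers.QuantumAdvantage.NaturalProofs: APPLIES squarely — its BARRIER block is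
addressed to this route. Under Literature.Barriers.PneNP.HardPRGExist no P/poly-natural property
proves X (NaturalProofs.no_naturalProof_bqp_not_ppoly) nor the crux FACT ∉ P/poly
(NaturalProofs.no_naturalProof_fact) [RazborovRudich1997 Thm 4.1; AroraBarakCC2009 Thm 23.1, Ch. 23
intro PDF p. 586: a natural proof of strong factoring lower bounds would refute its own premise].
NOT evaded: the bet is either conditional (ClbFactNotPpoly used as a hypothesis, which RR does not
touch) or a non-natural unconditional argument of algorithmic-method type (arXiv:2012.01920), which
today reaches only BQE.
- Literature.Barriers.QuantumAdvantage.SeparationPrerequisites: APPLIES a fortiori (the block names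
CircuitLB): X ⟹ summit ⟹ PP ⊄ BPP ∧ P ≠ PP ∧ P ≠ P^{#P} ∧ P ≠ PSPACE
(SeparationPrerequisites.of_facts, from Literature.Computability.QuantumComplexity.BQP_subset_PP
[AdlemanDeMarraisHuang1997] and BernsteinVazirani1997SICOMP §1 p. 1414); indeed X ⟹ PP ⊄ P/poly and
EXP ⊄ P/poly, both open (fixed-polynomial bounds Kannan1982-style are the frontier). NOT evaded: an
unconditional proof of X is a breakthrough in classical structural complexity; the route's
unconditional branch is deliberately undecomposed.
- Literature.Barriers.QuantumAdvantage.Relativization: its decls cover only the language shapes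
BQP^O ⊆ / ⊄ BPP^O and its scope

History (route lifecycle, newest last):
- 2026-08-15T10:45:05Z · CLOSED superseded — superseded:route-QuantumAdvantage-Shor — conditional-complete — Assembly+ClbFactBridge proved in tree, ClbAdleman=BPP_subset_PPoly_holds, FACT_mem_BQP_holds landed; FACT∉P/poly ⟹ FACT∉BPP: bridge = Sh (planner-QuantumAdvantage-route-QuantumAdvantage-CircuitLB-0)

sub-problem: QuantumAdvantage · status: closed(superseded) · opened planner-QuantumAdvantage-Survey-0 2026-08-13T06:04:29Z · rev 1 · ledger route-QuantumAdvantage-CircuitLB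
GENERATED by the gate from the ledger (D-0016/17). Provers cite these decls: `theorem foo : Summit.QuantumAdvantage.QuantumAdvantage.Theses.CircuitLB.<Decl> := …` in Summits/QuantumAdvantage/QuantumAdvantage/Theorems/<Name>.lean.
-/

namespace Summit.QuantumAdvantage.QuantumAdvantage.Theses.CircuitLB

open scoped BigOperators Topology Manifold Classical MeasureTheory ProbabilityTheory Matrix InnerProductSpace ComplexConjugate ContinuousMap
open Filter Set Function TopologicalSpace MeasureTheory

attribute [summit_statement] _root_.QuantumAdvantage

open Literature.QuantumAdvantage

/-- item stmt-QuantumAdvantage-0252 · target · rank 0 · closed · moot by None · by planner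
why it might fail: May be false: BQP ⊆ P/poly follows from BQP = BPP (Adleman) or any nonuniform dequantisation, and holds relative to a PSPACE-complete oracle. If true it is far off: X ⟹ PP ⊄ P/poly ⟹ EXP ⊄ P/poly (open; frontier MA_EXP ⊄ P/poly, BQE ⊄ C via quantum learners); natural proofs barred under hard PRGs.
sources: Adleman1978, AroraBarakCC2009 Thm 7.14, Def 6.5, Thm 23.1, RazborovRudich1997 Thm 4.1, arXiv:2012.01920 (Arunachalam–Grilo–Gur–Oliveira–Sundaram 2021, Thm 1: BQE ⊄ C[n^k] from non-trivial quantum learners), Literature.Barriers.QuantumAdvantage.NaturalProofs (NaturalProofs.no_naturalProof_bqp_not_ppoly), Literature.Barriers.QuantumAdvantage.SeparationPrerequisites (SeparationPrerequisites.of_facts; with Literature.Computability.QuantumComplexity.BQP_subset_PP)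
Thesis X of route CircuitLB: some BQP language has no polynomial-size B₂-circuit family. Strictly
stronger than BQP ≠ BPP (Adleman). Subject to the natural-proofs barrier (RazborovRudich1997).
[Adleman1978; AroraBarak2009 Def. 6.5] -/
@[route_item "route-QuantumAdvantage-CircuitLB"]
def ClbThesis : Prop :=
  ¬ (Literature.Computability.Cryptography.BQP ⊆ Literature.Computability.Complexity.PPoly)

/-- item stmt-QuantumAdvantage-0255 · crux · rank 3 · closed · moot by None · by planner
why it might fail: Open conjecture, may be false: factoring may have poly-size circuits (FACT ∈ P open, Literature.Computability.QuantumComplexity.FactInP; free precomputation already beats uniform attacks on RSA-3072, Bernstein–Lange 2013); no natural proof under hard PRGs (RR97); implies NP ⊄ P/poly. Hypothesis-type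
sources: Goldreich2001 §2.2.5 Def 2.2.6 (lit: book:goldreich2004-foundations-cryptography p.62), AroraBarakCC2009 §9 and Thm 23.1 / Ch. 23 intro (PDF p. 586), RazborovRudich1997 Thm 4.1, book:sako2013-advances-cryptology-asiacrypt-2013-19th-international-conference p.414 (Bernstein–Lange, Non-uniform cracks in the concrete, ASIACRYPT 2013, LNCS 8270 pp. 321–340), Literature.Barriers.QuantumAdvantage.NaturalProofs (NaturalProofs.no_naturalProof_fact), Literature.Computability.QuantumComplexity.FactInP (pqc.S04, open)
The nonuniform factoring assumption (factoring is hard for polynomial-size circuits; the assumption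
behind RSA/Rabin against nonuniform adversaries). Not expected to be proved; filed as the standard
instantiation of X. [Goldreich2001 §2.2 (nonuniform one-wayness), AroraBarak2009 §9] -/
@[route_item "route-QuantumAdvantage-CircuitLB"]
def ClbFactNotPpoly : Prop :=
  Literature.Computability.QuantumComplexity.FACT ∉ Literature.Computability.Complexity.PPoly

/-- item stmt-QuantumAdvantage-0254 · support · rank 2 · closed · moot by None · by planner
sources: Adleman1978, AroraBarakCC2009 Thm 7.14 (p. 136) and Thm 6.6, Literature.Computability.Complexity.BPP_subset_PPoly_holds (Literature/Computability/Complexity/CircuitClassesUniformProofs.lean:93)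
Discharge the named fact: amplify a BPP machine to error < 2^{-(n+1)} (Chernoff, poly(n)
repetitions), union bound over the 2^n inputs of length n gives one good coin string r_n, hard-wire
r_n into the polynomial-size circuit simulating the deterministic machine (needs P ⊆ P/poly,
Literature.Computability.Complexity.P_subset_PPoly, over G01 Circuit/B2). [Adleman1978;
AroraBarak2009 Thm 7.14, Thm 6.6] -/
@[route_item "route-QuantumAdvantage-CircuitLB"]
def ClbAdleman : Prop :=
  Literature.Computability.Complexity.BPP_subset_PPoly

/-- item stmt-QuantumAdvantage-0256 · support · rank 4 · closed · moot by None · by planner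
sources: Shor1997 §5, Literature.QuantumAdvantage.not_BQP_subset_PPoly_of_FACT (Summits/QuantumAdvantage/QuantumAdvantage/Theorems/CircuitLBAssembly.lean)
One line: FACT ∈ BQP ⊆ P/poly would contradict FACT ∉ P/poly. Links CircuitLB to route Shor's crux
#2/#3. [Shor1997 §5] -/
@[route_item "route-QuantumAdvantage-CircuitLB"]
def ClbFactBridge : Prop :=
  Literature.Computability.Cryptography.FACT_mem_BQP → Literature.Computability.QuantumComplexity.FACT ∉ Literature.Computability.Complexity.PPoly → ¬ (Literature.Computability.Cryptography.BQP ⊆ Literature.Computability.Complexity.PPoly)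

/-- item stmt-QuantumAdvantage-0253 · assembly · rank 1 · closed · moot by None · by planner
If BQP = BPP ⊆ P/poly then BQP ⊆ P/poly. One line, with the named fact BPP ⊆ P/poly (Adleman1978,
crux #2) as hypothesis. -/
@[route_item "route-QuantumAdvantage-CircuitLB"]
def Assembly : Prop :=
  Literature.Computability.Complexity.BPP_subset_PPoly → ¬ (Literature.Computability.Cryptography.BQP ⊆ Literature.Computability.Complexity.PPoly) → QuantumAdvantage

end Summit.QuantumAdvantage.QuantumAdvantage.Theses.CircuitLB
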